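import Summits.AtomisticToContinuum.BoseEinsteinCondensation.Theorems.BECThomsonPrincipleGaussianDominationCanThetaNorm
import Summits.AtomisticToContinuum.BoseEinsteinCondensation.Theorems.BECThomsonPrincipleGaussianDominationCanFreeCase
import Summits.AtomisticToContinuum.BoseEinsteinCondensation.Theorems.BECThomsonPrincipleGaussianDominationCanDefs
import Summits.AtomisticToContinuum.BoseEinsteinCondensation.Theorems.GaussianDominationCan.Negative.StructureII
import HarnessLib

/-!
# Crux `GaussianDominationCan`, line `coupling-monotone-chord` — side stubs S1–S3 (the chord cuts)

Crux `GaussianDominationCan` (`stmt-AtomisticToContinuum-9479`, route `BECThomsonPrinciple`), line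
`coupling-monotone-chord`, skeleton r8 (`Cruxes/GaussianDominationCan/Lines/coupling_monotone_chord.lean`).
The chord inequality `GDIneq v m L n C s Φ : E₀(v) + s·2N|I(Φ)| ≤ E_v(Φ) + C s² L²/‖n‖∞²`
(`Negative.CruxForms`) needs NO sign outside the core range of source strengths; this file certifies
the three cuts:

* S1 `stub_lnssSourceBound` — the kinematic bound `|⟨Φ, Λ_k†Φ⟩|² = (N|I(Φ)|)² ≤ N`: the source is
  `I = ∫ conj(ĉ_k)·Θ` with `ĉ_k = P₀(conj(e^{ik·x₀})ψ)` (self-adjointness of `P₀`,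
  `Negative.integral_conj_mul_cellAvg`, and `P₀Θ = Θ`), Cauchy–Schwarz in `ℝ≥0∞`,
  `∫|ĉ_k|² ≤ ∫|ψ|² = 1` (`P₀` is an `L²`-contraction on continuous functions: `⟨Pg, Pg⟩ = ⟨Pg, g⟩`
  by self-adjointness + idempotence, then Cauchy–Schwarz) and `N∫|Θ|² ≤ 1` (`stub_thetaNorm`);
* S2 `stub_chordAutomatic` — for `2√N‖n‖² ≤ C s L²` the chord is automatic for EVERY `v`
  (`E₀ ≤ E(Φ)` and `2sN|I| ≤ 2s√N ≤ C s²L²/‖n‖²`, by S1);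
* S3 `stub_anchorBand` — above the anchor band, `E₀(v) ≤ (C − 1/4π²)s²L²/‖n‖²`, the chord with
  constant `C` follows from the proved free chord `stub_freeCase` (sharp `1/(4π²)`),
  `E_0(Φ) ≤ E_v(Φ)` (`periodicEnergy_mono`) and `E₀(0) ≥ 0`.

References: E. H. Lieb, R. Seiringer, J. P. Solovej, J. Yngvason, *The Mathematics of the Bose Gas
and its Condensation* (2005), App. A; M. Lewin, P. T. Nam, S. Serfaty, J. P. Solovej,
*Comm. Pure Appl. Math.* 68 (2015) 413 (the excitation map, `‖Λ_k‖ ≤ √N`).  All statements here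
are [folklore].
-/

noncomputable section

namespace Summit.AtomisticToContinuum.BoseEinsteinCondensation.Cruxes.GaussianDominationCan.CouplingMonotoneChord

open MeasureTheory
open scoped ENNReal NNReal ComplexConjugate
open Literature.MathematicalPhysics.QuantumManyBody.BoseGas
open Summit.AtomisticToContinuum.BoseEinsteinCondensation.Theorems.GaussianDominationCan.Negative

/-! ## Helper lemmas (private; the continuity / Cauchy–Schwarz ones are adapted from
`…GaussianDominationCanFreeAnchorOf.lean` and `…GaussianDominationCanThetaNorm.lean`, where they are
private) -/

/-- The crux's phase `e^{ik·x₀}` is continuous on configuration space. [folklore] -/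
private theorem continuous_phase_cc (m : ℕ) (L : ℝ) (n : Fin 3 → ℤ) : Continuous (phase m L n) := by
  have h : phase m L n = fun X => cellWave L n (X 0) := funext (phase_eq_cellWave m L n)
  rw [h]
  exact (contDiff_cellWave L n).continuous.comp (continuous_apply 0)

/-- The crux's phase is unimodular: `|e^{ik·x₀}| = 1`. [folklore] -/
private theorem norm_phase_cc (m : ℕ) (L : ℝ) (n : Fin 3 → ℤ) (X : Config (m + 1)) :
    ‖phase m L n X‖ = 1 := by
  rw [phase_eq_cellWave, norm_cellWave]

/-- The crux's `foldr` of cell averages / fluctuations preserves continuity. [folklore] -/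
private theorem continuous_foldr_cellAvg_cc {N : ℕ} {L : ℝ} (S : Finset (Fin N))
    {g : Config N → ℂ} (hg : Continuous g) (l : List (Fin N)) :
    Continuous (l.foldr (fun i h => if i ∈ S then cellAvg N L i h else h - cellAvg N L i h) g) := by
  induction l with
  | nil => exact hg
  | cons a l ih =>
    rw [List.foldr_cons]
    split_ifs
    · exact continuous_cellAvg a ih
    · exact ih.sub (continuous_cellAvg a ih)

/-- `Θ = Σ_{S∋0} |S|^{-1/2} Q_S ψ` is continuous for continuous `ψ`. [folklore] -/
private theorem continuous_theta_cc (m : ℕ) (L : ℝ) {ψ : Config (m + 1) → ℂ} (hψ : Continuous ψ) :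
    Continuous (theta m L ψ) := by
  unfold theta modeProj
  exact continuous_finsetSum _ fun S _ =>
    continuous_const.mul (continuous_foldr_cellAvg_cc S hψ _)

/-- `P₀ Θ = Θ`: `Θ` does not depend on `x₀` and `∫_cell 1 = L³`. [folklore] -/
private theorem cellAvg_zero_theta_cc {m : ℕ} {L : ℝ} (hL : 0 < L) (ψ : Config (m + 1) → ℂ) :
    cellAvg (m + 1) L 0 (theta m L ψ) = theta m L ψ := by
  funext X
  show ((L ^ 3)⁻¹ : ℝ) • ∫ y in cell L, theta m L ψ (Function.update X 0 y) = _
  simp_rw [theta_update_zero]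
  rw [integral_cell_const hL, Complex.real_smul, ← mul_assoc]
  have hL' : (L : ℂ) ≠ 0 := by exact_mod_cast hL.ne'
  rw [show (((L ^ 3)⁻¹ : ℝ) : ℂ) * (L : ℂ) ^ 3 = 1 by
    rw [Complex.ofReal_inv, Complex.ofReal_pow, inv_mul_cancel₀ (pow_ne_zero 3 hL')], one_mul]

/-- **The source through the mode coefficient**: `I(ψ) = ∫ conj(ĉ_k)·Θ` with
`ĉ_k = P₀(conj(e^{ik·x₀}) ψ)` (self-adjointness of `P₀` and `P₀Θ = Θ`). [folklore] -/
private theorem sourceIntegral_eq_integral_conj_modeCoeff_cc {m : ℕ} {L : ℝ} (hL : 0 < L)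
    (n : Fin 3 → ℤ) {ψ : Config (m + 1) → ℂ} (hψ : Continuous ψ) :
    sourceIntegral m L n ψ =
      ∫ X in cellN (m + 1) L,
        conj (cellAvg (m + 1) L 0 (fun Y => conj (phase m L n Y) * ψ Y) X) * theta m L ψ X := by
  have hg : Continuous fun Y => conj (phase m L n Y) * ψ Y :=
    (Complex.continuous_conj.comp (continuous_phase_cc m L n)).mul hψ
  rw [← integral_conj_mul_cellAvg 0 hg (continuous_theta_cc m L hψ), cellAvg_zero_theta_cc hL]
  unfold sourceIntegral
  refine integral_congr_ae (Filter.Eventually.of_forall fun X => ?_)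
  show conj (ψ X) * phase m L n X * theta m L ψ X =
    conj (conj (phase m L n X) * ψ X) * theta m L ψ X
  rw [map_mul, Complex.conj_conj]
  ring

/-- **Cauchy–Schwarz** on `cell^N` in `ℝ≥0∞`: `‖∫ conj(f)·g‖² ≤ (∫|f|²)(∫|g|²)` for continuous
`f`, `g`. [folklore] -/
private theorem enorm_integral_conj_mul_sq_le_cc {N : ℕ} {L : ℝ} {f g : Config N → ℂ}
    (hf : Continuous f) (hg : Continuous g) :
    ‖∫ X in cellN N L, conj (f X) * g X‖ₑ ^ 2 ≤
      (∫⁻ X in cellN N L, (‖f X‖₊ : ℝ≥0∞) ^ 2) * ∫⁻ X in cellN N L, (‖g X‖₊ : ℝ≥0∞) ^ 2 := by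
  set μ : Measure (Config N) := (volume : Measure (Config N)).restrict (cellN N L)
  have h1 : ‖∫ X, conj (f X) * g X ∂μ‖ₑ ≤ ∫⁻ X, ‖f X‖ₑ * ‖g X‖ₑ ∂μ := by
    refine (enorm_integral_le_lintegral_enorm _).trans (lintegral_mono fun X => ?_)
    rw [enorm_mul, RCLike.enorm_conj]
  have h2 : ∫⁻ X, ‖f X‖ₑ * ‖g X‖ₑ ∂μ ≤
      (∫⁻ X, ‖f X‖ₑ ^ 2 ∂μ) ^ (1 / 2 : ℝ) * (∫⁻ X, ‖g X‖ₑ ^ 2 ∂μ) ^ (1 / 2 : ℝ) := by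
    have h := ENNReal.lintegral_mul_le_Lp_mul_Lq μ Real.HolderConjugate.two_two
      hf.aestronglyMeasurable.enorm hg.aestronglyMeasurable.enorm
    simpa only [Pi.mul_apply, ENNReal.rpow_two, one_div] using h
  calc ‖∫ X, conj (f X) * g X ∂μ‖ₑ ^ 2
      ≤ ((∫⁻ X, ‖f X‖ₑ ^ 2 ∂μ) ^ (1 / 2 : ℝ) * (∫⁻ X, ‖g X‖ₑ ^ 2 ∂μ) ^ (1 / 2 : ℝ)) ^ 2 := by
        gcongr
        exact h1.trans h2
    _ = (∫⁻ X, ‖f X‖ₑ ^ 2 ∂μ) * ∫⁻ X, ‖g X‖ₑ ^ 2 ∂μ := by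
        rw [mul_pow, ← ENNReal.rpow_two, ← ENNReal.rpow_two, ← ENNReal.rpow_mul,
          ← ENNReal.rpow_mul]
        norm_num

/-- `∫ conj(φ) φ = ∫ |φ|²` as a complex number. [folklore] -/
private theorem integral_conj_mul_self_cc {N : ℕ} {L : ℝ} (φ : Config N → ℂ) :
    ∫ X in cellN N L, conj (φ X) * φ X = ((∫ X in cellN N L, ‖φ X‖ ^ 2 : ℝ) : ℂ) := by
  simp_rw [Complex.conj_mul', ← Complex.ofReal_pow]
  exact integral_ofReal

/-- `∫⁻ ‖φ‖₊² = ofReal (∫ |φ|²)` on `cell^N` for continuous `φ`. [folklore] -/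
private theorem lintegral_nnnorm_sq_eq_cc {N : ℕ} {L : ℝ} (φ : Config N → ℂ) (hφ : Continuous φ) :
    ∫⁻ X in cellN N L, (‖φ X‖₊ : ℝ≥0∞) ^ 2 = ENNReal.ofReal (∫ X in cellN N L, ‖φ X‖ ^ 2) := by
  simp_rw [coe_nnnorm_sq_eq_ofReal]
  exact (ofReal_integral_eq_lintegral_ofReal (integrableOn_cellN (hφ.norm.pow 2) L)
    (Filter.Eventually.of_forall fun X => sq_nonneg ‖φ X‖)).symm

/-- **`P_i` is an `L²(cell^N)`-contraction on continuous functions**: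
`∫|P_i g|² ≤ ∫|g|²` (`⟨P g, P g⟩ = ⟨P(P g), g⟩ = ⟨P g, g⟩` by self-adjointness and idempotence, then
Cauchy–Schwarz and cancellation of the finite `∫|P g|²`). [folklore] -/
private theorem lintegral_cellAvg_sq_le {n : ℕ} {L : ℝ} (hL : 0 < L) (i : Fin (n + 1))
    {g : Config (n + 1) → ℂ} (hg : Continuous g) :
    ∫⁻ X in cellN (n + 1) L, (‖cellAvg (n + 1) L i g X‖₊ : ℝ≥0∞) ^ 2 ≤
      ∫⁻ X in cellN (n + 1) L, (‖g X‖₊ : ℝ≥0∞) ^ 2 := by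
  have hPg : Continuous (cellAvg (n + 1) L i g) := continuous_cellAvg i hg
  set A : ℝ≥0∞ := ∫⁻ X in cellN (n + 1) L, (‖cellAvg (n + 1) L i g X‖₊ : ℝ≥0∞) ^ 2 with hA
  set G : ℝ≥0∞ := ∫⁻ X in cellN (n + 1) L, (‖g X‖₊ : ℝ≥0∞) ^ 2 with hG
  -- `⟨Pg, Pg⟩ = ⟨Pg, g⟩`
  have h1 : ∫ X in cellN (n + 1) L, conj (cellAvg (n + 1) L i g X) * cellAvg (n + 1) L i g X =
      ∫ X in cellN (n + 1) L, conj (cellAvg (n + 1) L i g X) * g X := by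
    rw [integral_conj_mul_cellAvg i hPg hg, cellAvg_cellAvg hL i g]
  -- `‖⟨Pg, Pg⟩‖ₑ = A`
  have h2 : ‖∫ X in cellN (n + 1) L, conj (cellAvg (n + 1) L i g X) * cellAvg (n + 1) L i g X‖ₑ =
      A := by
    rw [integral_conj_mul_self_cc, ← ofReal_norm,
      Complex.norm_of_nonneg (integral_nonneg fun X => sq_nonneg _), hA,
      lintegral_nnnorm_sq_eq_cc _ hPg]
  -- Cauchy–Schwarz: `A² ≤ A·G`
  have h3 : A ^ 2 ≤ A * G := by
    calc A ^ 2 = ‖∫ X in cellN (n + 1) L, conj (cellAvg (n + 1) L i g X) * g X‖ₑ ^ 2 := by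
          rw [← h1, h2]
      _ ≤ A * G := enorm_integral_conj_mul_sq_le_cc hPg hg
  have hAtop : A ≠ ⊤ := by
    rw [hA, lintegral_nnnorm_sq_eq_cc _ hPg]
    exact ENNReal.ofReal_ne_top
  by_cases hA0 : A = 0
  · rw [hA0]; exact zero_le
  · rw [sq] at h3
    exact (ENNReal.mul_le_mul_iff_right hA0 hAtop).mp h3

/-! ## The stubs -/

/-- **Side stub S1 `stub_lnssSourceBound`** — the kinematic bound `|⟨Φ, Λ_k†Φ⟩|² = (N|I(Φ)|)² ≤ N`
for every periodic Bose trial state: `I = ∫ conj(ĉ_k)Θ`, Cauchy–Schwarz,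
`∫|ĉ_k|² ≤ ∫|ψ|² = 1` by `L²`-contractivity of `P₀` (and `|e^{ik·x₀}| = 1`), and
`N∫|Θ|² ≤ 1` (`stub_thetaNorm`). [folklore] -/
theorem stub_lnssSourceBound :
    ∀ (m : ℕ) (L : ℝ), 0 < L → ∀ (n : Fin 3 → ℤ) (Φ : PeriodicTrialState (m + 1) L),
      (((m + 1 : ℕ) : ℝ) * ‖sourceIntegral m L n Φ.ψ‖) ^ 2 ≤ ((m + 1 : ℕ) : ℝ) := by
  intro m L hL n Φ
  have hψ : Continuous Φ.ψ := Φ.contDiff.continuous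
  set g : Config (m + 1) → ℂ := fun Y => conj (phase m L n Y) * Φ.ψ Y with hgdef
  have hg : Continuous g := (Complex.continuous_conj.comp (continuous_phase_cc m L n)).mul hψ
  set I : ℂ := sourceIntegral m L n Φ.ψ with hI
  set A : ℝ≥0∞ := ∫⁻ X in cellN (m + 1) L, (‖cellAvg (m + 1) L 0 g X‖₊ : ℝ≥0∞) ^ 2 with hA
  set B : ℝ≥0∞ := ∫⁻ X in cellN (m + 1) L, (‖theta m L Φ.ψ X‖₊ : ℝ≥0∞) ^ 2 with hB
  -- Cauchy–Schwarz for the source written through the mode coefficient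
  have hCS : ‖I‖ₑ ^ 2 ≤ A * B := by
    rw [hI, sourceIntegral_eq_integral_conj_modeCoeff_cc hL n hψ]
    exact enorm_integral_conj_mul_sq_le_cc (continuous_cellAvg 0 hg) (continuous_theta_cc m L hψ)
  -- `∫|ĉ_k|² ≤ ∫|conj(phase)ψ|² = ∫|ψ|² = 1`
  have hAle : A ≤ 1 := by
    calc A ≤ ∫⁻ X in cellN (m + 1) L, (‖g X‖₊ : ℝ≥0∞) ^ 2 := lintegral_cellAvg_sq_le hL 0 hg
      _ = ∫⁻ X in cellN (m + 1) L, (‖Φ.ψ X‖₊ : ℝ≥0∞) ^ 2 := by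
          refine lintegral_congr fun X => ?_
          rw [coe_nnnorm_sq_eq_ofReal, coe_nnnorm_sq_eq_ofReal, hgdef]
          simp only [norm_mul, Complex.norm_conj, norm_phase_cc, one_mul]
      _ = 1 := Φ.norm_eq
  -- Bose counting
  have hBle : ((m + 1 : ℕ) : ℝ≥0∞) * B ≤ 1 := stub_thetaNorm m L hL Φ
  -- assemble in `ℝ≥0∞`
  have hkey : ((m + 1 : ℕ) : ℝ≥0∞) ^ 2 * ‖I‖ₑ ^ 2 ≤ ((m + 1 : ℕ) : ℝ≥0∞) := by
    calc ((m + 1 : ℕ) : ℝ≥0∞) ^ 2 * ‖I‖ₑ ^ 2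
        ≤ ((m + 1 : ℕ) : ℝ≥0∞) ^ 2 * (A * B) := by gcongr
      _ = ((m + 1 : ℕ) : ℝ≥0∞) * A * (((m + 1 : ℕ) : ℝ≥0∞) * B) := by ring
      _ ≤ ((m + 1 : ℕ) : ℝ≥0∞) * 1 * 1 := by gcongr
      _ = ((m + 1 : ℕ) : ℝ≥0∞) := by ring
  -- pass to real numbers
  have hlhs : ENNReal.ofReal ((((m + 1 : ℕ) : ℝ) * ‖I‖) ^ 2) =
      ((m + 1 : ℕ) : ℝ≥0∞) ^ 2 * ‖I‖ₑ ^ 2 := by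
    rw [mul_pow, ENNReal.ofReal_mul (by positivity), ← Nat.cast_pow, ENNReal.ofReal_natCast,
      Nat.cast_pow, ENNReal.ofReal_pow (norm_nonneg _), ofReal_norm]
  rw [← ENNReal.ofReal_le_ofReal_iff (Nat.cast_nonneg _), hlhs, ENNReal.ofReal_natCast]
  exact hkey

/-- **Side stub S2 `stub_chordAutomatic`** — above `s = 2√N‖n‖²/(C L²)` the chord is automatic for
EVERY `v`: `E₀ ≤ E(Φ)` (variational principle) and `s·2N|I| ≤ 2s√N ≤ C s²L²/‖n‖²` (S1).
[folklore] -/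
theorem stub_chordAutomatic :
    ∀ (v : ℝ → ℝ≥0∞) (m : ℕ) (L : ℝ), 0 < L → ∀ n : Fin 3 → ℤ, n ≠ 0 → ∀ (C s : ℝ), 0 ≤ s →
      2 * Real.sqrt ((m + 1 : ℕ) : ℝ) * ‖(fun j => (n j : ℝ))‖ ^ 2 ≤ C * s * L ^ 2 →
      ∀ Φ : PeriodicTrialState (m + 1) L, GDIneq v m L n C s Φ := by
  intro v m L hL n hn C s hs hyp Φ
  have hnorm : 0 < ‖(fun j => (n j : ℝ))‖ := one_pos.trans_le (one_le_norm_intVec hn)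
  -- S1: `N|I| ≤ √N`
  have hI : ((m + 1 : ℕ) : ℝ) * ‖sourceIntegral m L n Φ.ψ‖ ≤ Real.sqrt ((m + 1 : ℕ) : ℝ) :=
    Real.le_sqrt_of_sq_le (stub_lnssSourceBound m L hL n Φ)
  have h : s * (2 * (m + 1) * ‖sourceIntegral m L n Φ.ψ‖) ≤
      C * s ^ 2 * L ^ 2 / ‖(fun j => (n j : ℝ))‖ ^ 2 := by
    rw [le_div_iff₀ (by positivity)]
    calc s * (2 * (m + 1) * ‖sourceIntegral m L n Φ.ψ‖) * ‖(fun j => (n j : ℝ))‖ ^ 2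
        = s * ‖(fun j => (n j : ℝ))‖ ^ 2 *
            (2 * (((m + 1 : ℕ) : ℝ) * ‖sourceIntegral m L n Φ.ψ‖)) := by push_cast; ring
      _ ≤ s * ‖(fun j => (n j : ℝ))‖ ^ 2 * (2 * Real.sqrt ((m + 1 : ℕ) : ℝ)) := by gcongr
      _ = s * (2 * Real.sqrt ((m + 1 : ℕ) : ℝ) * ‖(fun j => (n j : ℝ))‖ ^ 2) := by ring
      _ ≤ s * (C * s * L ^ 2) := mul_le_mul_of_nonneg_left hyp hs
      _ = C * s ^ 2 * L ^ 2 := by ring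
  unfold GDIneq
  exact add_le_add (periodicGroundStateEnergy_le v Φ) (ENNReal.ofReal_le_ofReal h)

/-- **Side stub S3 `stub_anchorBand`** — the anchor band: if `E₀(v) ≤ (C − 1/4π²) s² L²/‖n‖²` then
the chord with constant `C` at `s` holds for every trial state (free chord `stub_freeCase` with the
sharp `1/(4π²)`, `E₀(0) ≥ 0`, `E_0(Φ) ≤ E_v(Φ)`, and `ofReal a + ofReal b = ofReal (a + b)` for the two
non-negative penalties). [folklore] -/
theorem stub_anchorBand :
    ∀ (v : ℝ → ℝ≥0∞) (m : ℕ) (L : ℝ), 0 < L → ∀ n : Fin 3 → ℤ, n ≠ 0 → ∀ (C s : ℝ), 1 / (4 * Real.pi ^ 2) ≤ C → 0 ≤ s →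
      periodicGroundStateEnergy v (m + 1) L ≤
        ENNReal.ofReal ((C - 1 / (4 * Real.pi ^ 2)) * s ^ 2 * L ^ 2 / ‖(fun j => (n j : ℝ))‖ ^ 2) →
      ∀ Φ : PeriodicTrialState (m + 1) L, GDIneq v m L n C s Φ := by
  intro v m L hL n hn C s hC hs hE Φ
  have hfree := stub_freeCase m L hL n hn s hs Φ
  unfold GDIneq at hfree ⊢
  set J : ℝ≥0∞ := ENNReal.ofReal (s * (2 * (m + 1) * ‖sourceIntegral m L n Φ.ψ‖)) with hJ
  set nv : ℝ := ‖(fun j => (n j : ℝ))‖ with hnv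
  have ha : 0 ≤ 1 / (4 * Real.pi ^ 2) * s ^ 2 * L ^ 2 / nv ^ 2 := by positivity
  have hb : 0 ≤ (C - 1 / (4 * Real.pi ^ 2)) * s ^ 2 * L ^ 2 / nv ^ 2 :=
    div_nonneg (mul_nonneg (mul_nonneg (sub_nonneg.mpr hC) (sq_nonneg _)) (sq_nonneg _))
      (sq_nonneg _)
  -- the free chord without `E₀(0) ≥ 0`, then `E_0(Φ) ≤ E_v(Φ)`
  have h1 : J ≤ periodicEnergy v Φ + ENNReal.ofReal (1 / (4 * Real.pi ^ 2) * s ^ 2 * L ^ 2 / nv ^ 2) :=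
    le_add_self.trans (hfree.trans
      (add_le_add (periodicEnergy_mono (fun _ => zero_le) Φ) le_rfl))
  calc periodicGroundStateEnergy v (m + 1) L + J
      ≤ ENNReal.ofReal ((C - 1 / (4 * Real.pi ^ 2)) * s ^ 2 * L ^ 2 / nv ^ 2) +
          (periodicEnergy v Φ + ENNReal.ofReal (1 / (4 * Real.pi ^ 2) * s ^ 2 * L ^ 2 / nv ^ 2)) :=
        add_le_add hE h1
    _ = periodicEnergy v Φ + (ENNReal.ofReal (1 / (4 * Real.pi ^ 2) * s ^ 2 * L ^ 2 / nv ^ 2) +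
          ENNReal.ofReal ((C - 1 / (4 * Real.pi ^ 2)) * s ^ 2 * L ^ 2 / nv ^ 2)) := by ring
    _ = periodicEnergy v Φ + ENNReal.ofReal (C * s ^ 2 * L ^ 2 / nv ^ 2) := by
        rw [← ENNReal.ofReal_add ha hb]
        congr 2
        ring

end Summit.AtomisticToContinuum.BoseEinsteinCondensation.Cruxes.GaussianDominationCan.CouplingMonotoneChord

end
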